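import Literature.Probability.LatticeModels.LatticeGreenOriginBound
import Literature.Probability.LatticeModels.LatticePotentialKernelBounds
import Mathlib.Analysis.Convex.Integral
import Mathlib.Analysis.Convex.SpecificFunctions.Pow
import Mathlib.MeasureTheory.Integral.IntegralEqImproper
import HarnessLib

/-!
# `ν R(ν)` is non-increasing in the dimension (Salmhofer–Seiler 1991, Proposition A.6)

Topic `Probability/LatticeModels`, namespace `Literature.Probability.LatticeModels`; companion of
`LatticeGreenOriginBound.lean` (Salmhofer–Seiler's Lemma A.4: `r(x) ≤ (1 + 2x)^{-1/2}`,
`R(d) ≤ 1/(d - 2)`), `LatticeGreenHeatKernel.lean` ((A.7): `latticeGreen x = ∫₀^∞ ∏ᵢ q_t(xᵢ) dt`)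
and `SRWHeatKernel1D.lean` (`srwHeatKernel t 0 = r(t) = (1/2π)∫_{-π}^{π} e^{-t(1 - cos k)} dk =
I₀(t)e^{-t}`; `r(0) = 1` is `srwHeatKernel_zero_left_zero`, continuity in `t` is
`continuous_srwHeatKernel_left`).  Here `R(ν) = latticeGreen (0 : Site ν) = ∫ d^νk/((2π)^ν Σ_μ(1 - cos k_μ))` is the
lattice Green function of `ℤ^ν` at the origin — the constant of the Fröhlich–Simon–Spencer infrared
bound and the `R(ν)` of the Appendix of

* M. Salmhofer, E. Seiler, *Proof of chiral symmetry breaking in strongly coupled lattice gauge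
  theory*, Commun. Math. Phys. **139** (1991) 395–432, Appendix: Prop. A.2 (1) (A.7), Remark A.3,
  Lemma A.4, **Proposition A.6** (p. 427: "Let `ν ∈ ℝ`, `ν ≥ 3`. Then `ν R(ν)` is a decreasing
  function of `ν`."), used on p. 418 (Prop. 4.2 (2): "both upper bounds are decreasing functions of
  `ν`") and p. 430–431 ((A.60)–(A.61): chiral symmetry breaking "for `ν = 4` and also all `ν ≥ 4`")
  [SalmhoferSeiler1991].

PROVED here (theorems only; no definition, no named fact):

* `srwHeatKernel_zero_mul_le_rpow` — `r` is LOG-CONVEX with `r(0) = 1`: `r(λx) ≤ r(x)^λ` for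
  `0 ≤ λ ≤ 1` (Jensen's inequality for the concave power `u ↦ u^λ` and the average
  `r(x) = ⨍_{[-π,π]} e^{-x(1 - cos k)} dk`);
* `srwHeatKernel_zero_div_rpow_le` — hence `r(s/ν')^{ν'} ≤ r(s/ν)^{ν}` for `0 < ν ≤ ν'`;
* `integrableOn_srwHeatKernel_zero_rpow` — (A.7) for REAL `ν > 2` (Remark A.3): `t ↦ r(t)^ν` is
  integrable on `(0, ∞)` with `∫₀^∞ r(t)^ν dt ≤ 1/(ν - 2)`;
* (private plumbing) the substitution `t = s/ν`: `ν ∫₀^∞ r(t)^ν dt = ∫₀^∞ r(s/ν)^ν ds`;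
* **`mul_integral_srwHeatKernel_zero_rpow_antitoneOn`** — **Proposition A.6**: `ν ↦ ν ∫₀^∞ r(t)^ν dt`
  is antitone on `(2, ∞)` (the print states `ν ≥ 3`; `mul_integral_srwHeatKernel_zero_rpow_le_of_le`
  is the printed form);
* **`dim_mul_latticeGreen_zero_le_of_le`** — on the lattice: `d' R(d') ≤ d R(d)` for `3 ≤ d ≤ d'`
  (`succ_mul_latticeGreen_zero_le`, `latticeGreen_zero_le_of_le`: `R` itself is non-increasing).

About the proof.  The printed proof ((A.29)–(A.35)) differentiates (A.7) under the integral sign,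
integrates by parts twice using `ν e^{-νx} = -(d/dx)e^{-νx}` and the Bessel function `I₁`, and shows
the resulting integrand `φ ≤ 0` with (A.21)–(A.22).  We take a shorter road to the same statement:
after `t = s/ν` one has `ν R(ν) = ∫₀^∞ r(s/ν)^ν ds`, and for fixed `s` the integrand is
non-increasing in `ν` because `log r` is convex and vanishes at `0` (so `log r(x)/x` is
non-decreasing); log-convexity of `r(x) = ⨍ e^{-x(1 - cos k)} dk` is Hölder/Jensen.  No Bessel-function
identities are needed, and the statement comes out on the whole range `ν > 2` where (A.7) converges.
In random-walk language `d R(d) = G_d(0,0)` is the expected number of visits to the origin of simple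
random walk on `ℤ^d`, which therefore does not increase with `d`.

Downstream (`ComplexSpinChiralLROMonotone.lean`): Salmhofer–Seiler's Prop. 4.2 (2) monotonicity
clause `S(ν) ≤ ν₀R(ν₀) - 3/4` for `ν ≥ ν₀`, and the reduction (A.60) of chiral long-range order in
all dimensions `ν ≥ 4` to the single number `R(4)`.

## References

* M. Salmhofer, E. Seiler, Commun. Math. Phys. 139 (1991) 395–432, Appendix, Prop. A.2, Remark A.3,
  Lemma A.4, Proposition A.6 (p. 427), (A.60)–(A.61) (pp. 430–431). [SalmhoferSeiler1991]
* J. Fröhlich, B. Simon, T. Spencer, Commun. Math. Phys. 50 (1976) 79–95 (the infrared constant).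
  [FrohlichSimonSpencer1976]

## Mathlib

`ConcaveOn.le_map_set_average` (Jensen) with `Real.concaveOn_rpow`, `Real.exp_mul`
(`e^{xy} = (e^x)^y`), `MeasureTheory.integral_comp_mul_left_Ioi` /
`integrableOn_Ioi_comp_mul_left_iff` (the substitution), `integral_Ioi_of_hasDerivAt_of_nonneg'`
(the majorant `∫₀^∞ (1 + 2x)^{-ν/2} dx = 1/(ν - 2)` for real `ν`), `setIntegral_mono_on`.
-/

noncomputable section

open MeasureTheory Set Filter Real
open scoped Topology

namespace Literature.Probability.LatticeModels

variable {d : ℕ}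

/-! ### `r(x) = q_x(0)`: positivity (`r(0) = 1` is the tree's `srwHeatKernel_zero_left_zero`,
continuity in `x` the tree's `continuous_srwHeatKernel_left`) -/

/-- `r(x) > 0` for every real `x`: the integrand of (A.24) is positive (the printed `0 ≤ r(x)` of
(A.22), sharpened). [cite: SalmhoferSeiler1991, Lemma A.4 (1), (A.22) with (A.24)] -/
theorem srwHeatKernel_zero_pos (t : ℝ) : 0 < srwHeatKernel t 0 := by
  rw [srwHeatKernel_zero_eq]
  refine div_pos ?_ (by positivity)
  refine intervalIntegral.intervalIntegral_pos_of_pos ?_ (fun k => Real.exp_pos _)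
    (by linarith [Real.pi_pos])
  exact (by fun_prop : Continuous fun k : ℝ =>
    Real.exp (-(t * (1 - Real.cos k)))).intervalIntegrable _ _

/-! ### Log-convexity of `r`: `r(λx) ≤ r(x)^λ` -/

/-- **`r = I₀e^{-x}` is log-convex; since `r(0) = 1`: `r(λ x) ≤ r(x)^λ` for `0 ≤ λ ≤ 1`.**
Proof: `r(x) = ⨍_{[-π,π]} e^{-x(1 - cos k)} dk` is an average and
`e^{-λx(1-cos k)} = (e^{-x(1 - cos k)})^λ`, so this is Jensen's inequality for the concave power
`u ↦ u^λ`.  (Equivalently: `r` is the Laplace transform of the law of `1 - cos Θ`, `Θ` uniform, and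
Laplace transforms of probability measures are log-convex.)  This is the pointwise inequality behind
Proposition A.6 in the form proved here. [cite: SalmhoferSeiler1991, Proposition A.6 (pointwise form, from (A.24))] -/
theorem srwHeatKernel_zero_mul_le_rpow {lam x : ℝ} (h0 : 0 ≤ lam) (h1 : lam ≤ 1) :
    srwHeatKernel (lam * x) 0 ≤ srwHeatKernel x 0 ^ lam := by
  have hle : (-π : ℝ) ≤ π := by linarith [Real.pi_pos]
  set f : ℝ → ℝ := fun k => Real.exp (-(x * (1 - Real.cos k))) with hf
  have hfc : Continuous f := by simp only [hf]; fun_prop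
  have hgf : (fun k => f k ^ lam) = fun k => Real.exp (-(lam * x * (1 - Real.cos k))) := by
    funext k
    simp only [hf]
    rw [← Real.exp_mul]
    ring_nf
  have hgfc : Continuous fun k => f k ^ lam := by rw [hgf]; fun_prop
  -- the two averages
  have hvol : (volume : Measure ℝ).real (Ioc (-π) π) = 2 * π := by
    rw [Real.volume_real_Ioc_of_le hle]; ring
  have havg_f : ⨍ k in Ioc (-π) π, f k = srwHeatKernel x 0 := by
    rw [setAverage_eq, hvol, srwHeatKernel_zero_eq, intervalIntegral.integral_of_le hle,
      smul_eq_mul]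
    simp only [hf]
    ring
  have havg_g : ⨍ k in Ioc (-π) π, f k ^ lam = srwHeatKernel (lam * x) 0 := by
    rw [setAverage_eq, hvol, srwHeatKernel_zero_eq, intervalIntegral.integral_of_le hle,
      smul_eq_mul, hgf]
    ring
  have h0vol : (volume : Measure ℝ) (Ioc (-π) π) ≠ 0 := by
    rw [Real.volume_Ioc]
    have : (0 : ℝ) < π - -π := by linarith [Real.pi_pos]
    simpa using this
  have htop : (volume : Measure ℝ) (Ioc (-π) π) ≠ ⊤ := by
    rw [Real.volume_Ioc]; exact ENNReal.ofReal_ne_top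
  have hJ := (Real.concaveOn_rpow h0 h1).le_map_set_average
    (Real.continuous_rpow_const h0).continuousOn isClosed_Ici h0vol htop
    (Eventually.of_forall fun k => (Real.exp_pos _).le)
    (hfc.integrableOn_Ioc) (hgfc.integrableOn_Ioc)
  rw [havg_g, havg_f] at hJ
  exact hJ

/-- The scaling form of log-convexity: for `0 < ν ≤ ν'` and any `s`,
`r(s/ν')^{ν'} ≤ r(s/ν)^{ν}` — the integrand of `ν R(ν) = ∫₀^∞ r(s/ν)^ν ds` is pointwise
non-increasing in `ν` (the integrand-level statement of Proposition A.6).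
[cite: SalmhoferSeiler1991, Proposition A.6 (integrand form, from (A.24))] -/
theorem srwHeatKernel_zero_div_rpow_le {ν ν' : ℝ} (hν : 0 < ν) (hle : ν ≤ ν') (s : ℝ) :
    srwHeatKernel (s / ν') 0 ^ ν' ≤ srwHeatKernel (s / ν) 0 ^ ν := by
  have hν' : 0 < ν' := lt_of_lt_of_le hν hle
  have hlam0 : 0 ≤ ν / ν' := div_nonneg hν.le hν'.le
  have hlam1 : ν / ν' ≤ 1 := (div_le_one hν').2 hle
  have h1 : srwHeatKernel (s / ν') 0 ≤ srwHeatKernel (s / ν) 0 ^ (ν / ν') := by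
    have h := srwHeatKernel_zero_mul_le_rpow (x := s / ν) hlam0 hlam1
    have hs : ν / ν' * (s / ν) = s / ν' := by field_simp
    rwa [hs] at h
  have h0 : 0 ≤ srwHeatKernel (s / ν') 0 := (srwHeatKernel_zero_pos _).le
  have hr : 0 ≤ srwHeatKernel (s / ν) 0 := (srwHeatKernel_zero_pos _).le
  calc srwHeatKernel (s / ν') 0 ^ ν' ≤ (srwHeatKernel (s / ν) 0 ^ (ν / ν')) ^ ν' :=
        Real.rpow_le_rpow h0 h1 hν'.le
    _ = srwHeatKernel (s / ν) 0 ^ ν := by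
        rw [← Real.rpow_mul hr]
        congr 1
        field_simp

/-! ### (A.7) for real `ν > 2`: integrability, and `ν R(ν) = ∫₀^∞ r(s/ν)^ν ds` -/

/-- The majorant `∫₀^∞ (1 + 2x)^{-ν/2} dx = 1/(ν - 2)` for REAL `ν > 2`, with integrability
(calculus plumbing for the real-`ν` (A.23)). [folklore] -/
private theorem integral_Ioi_one_add_two_mul_rpow_real {ν : ℝ} (hν : 2 < ν) :
    IntegrableOn (fun t : ℝ => (1 + 2 * t) ^ (-ν / 2)) (Ioi 0) ∧
      ∫ t in Ioi (0 : ℝ), (1 + 2 * t) ^ (-ν / 2) = 1 / (ν - 2) := by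
  have hd2 : 0 < ν - 2 := by linarith
  set p : ℝ := -(ν - 2) / 2 with hp
  have hp_neg : p < 0 := by rw [hp]; linarith
  set G : ℝ → ℝ := fun t => -((1 + 2 * t) ^ p) / (ν - 2) with hG
  have hderiv : ∀ t ∈ Ici (0 : ℝ), HasDerivAt G ((1 + 2 * t) ^ (-ν / 2)) t := by
    intro t ht
    have hbase : 0 < 1 + 2 * t := by linarith [mem_Ici.1 ht]
    have h1 : HasDerivAt (fun t : ℝ => 1 + 2 * t) 2 t := by
      simpa using ((hasDerivAt_id t).const_mul (2 : ℝ)).const_add 1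
    have h2 : HasDerivAt (fun t : ℝ => (1 + 2 * t) ^ p) (2 * p * (1 + 2 * t) ^ (p - 1)) t :=
      h1.rpow_const (Or.inl hbase.ne')
    have h3 := (h2.neg).div_const (ν - 2)
    refine h3.congr_deriv ?_
    have hexp : p - 1 = -ν / 2 := by rw [hp]; ring
    rw [hexp, hp]
    field_simp
  have hpos : ∀ t ∈ Ioi (0 : ℝ), 0 ≤ (1 + 2 * t) ^ (-ν / 2) := fun t ht =>
    Real.rpow_nonneg (by linarith [mem_Ioi.1 ht]) _
  have hlim : Tendsto G atTop (𝓝 0) := by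
    have h1 : Tendsto (fun t : ℝ => 1 + 2 * t) atTop atTop :=
      tendsto_atTop_add_const_left _ _ (tendsto_id.const_mul_atTop (by norm_num : (0 : ℝ) < 2))
    have h2 : Tendsto (fun t : ℝ => (1 + 2 * t) ^ p) atTop (𝓝 0) := by
      have h3 := (tendsto_rpow_neg_atTop (y := (ν - 2) / 2) (by linarith)).comp h1
      have hp' : -((ν - 2) / 2) = p := by rw [hp]; ring
      rw [hp'] at h3
      exact h3
    have h4 := (h2.neg).div_const (ν - 2)
    simpa using h4
  refine ⟨integrableOn_Ioi_deriv_of_nonneg' hderiv hpos hlim, ?_⟩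
  rw [integral_Ioi_of_hasDerivAt_of_nonneg' hderiv hpos hlim]
  simp only [hG, mul_zero, add_zero, Real.one_rpow, zero_sub]
  ring

/-- (A.22) in real-power form: `r(t)^ν ≤ (1 + 2t)^{-ν/2}` for `t ≥ 0`, `ν ≥ 0`.
[cite: SalmhoferSeiler1991, Lemma A.4, (A.22)] -/
theorem srwHeatKernel_zero_rpow_le {t ν : ℝ} (ht : 0 ≤ t) (hν : 0 ≤ ν) :
    srwHeatKernel t 0 ^ ν ≤ (1 + 2 * t) ^ (-ν / 2) := by
  have h1 := srwHeatKernel_zero_le_inv_sqrt ht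
  have hbase : 0 < 1 + 2 * t := by linarith
  have hsq : 1 / Real.sqrt (1 + 2 * t) = (1 + 2 * t) ^ (-(1 / 2 : ℝ)) := by
    rw [Real.sqrt_eq_rpow, Real.rpow_neg hbase.le, one_div]
  rw [hsq] at h1
  calc srwHeatKernel t 0 ^ ν ≤ ((1 + 2 * t) ^ (-(1 / 2 : ℝ))) ^ ν :=
        Real.rpow_le_rpow (srwHeatKernel_zero_nonneg t) h1 hν
    _ = (1 + 2 * t) ^ (-ν / 2) := by
        rw [← Real.rpow_mul hbase.le]
        congr 1
        ring

/-- **(A.7) makes sense for real `ν > 2`** (Remark A.3: "the integral (A.7) defines a continuation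
of `R` to real values of `ν > 2`"): `t ↦ r(t)^ν` is integrable on `(0, ∞)`, and
`∫₀^∞ r(t)^ν dt ≤ 1/(ν - 2)` ((A.23) for real `ν`). [cite: SalmhoferSeiler1991, Remark A.3, (A.7), (A.23)] -/
theorem integrableOn_srwHeatKernel_zero_rpow {ν : ℝ} (hν : 2 < ν) :
    IntegrableOn (fun t : ℝ => srwHeatKernel t 0 ^ ν) (Ioi 0) ∧
      ∫ t in Ioi (0 : ℝ), srwHeatKernel t 0 ^ ν ≤ 1 / (ν - 2) := by
  obtain ⟨hmaj, hval⟩ := integral_Ioi_one_add_two_mul_rpow_real hν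
  have hν0 : 0 ≤ ν := by linarith
  have hcont : Continuous fun t : ℝ => srwHeatKernel t 0 ^ ν :=
    (continuous_srwHeatKernel_left 0).rpow_const fun _ => Or.inr hν0
  have hint : IntegrableOn (fun t : ℝ => srwHeatKernel t 0 ^ ν) (Ioi 0) := by
    refine Integrable.mono' hmaj hcont.aestronglyMeasurable ?_
    filter_upwards [ae_restrict_mem measurableSet_Ioi] with t ht
    rw [Real.norm_eq_abs, abs_of_nonneg (Real.rpow_nonneg (srwHeatKernel_zero_nonneg t) _)]
    exact srwHeatKernel_zero_rpow_le (le_of_lt (mem_Ioi.1 ht)) hν0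
  refine ⟨hint, ?_⟩
  rw [← hval]
  refine setIntegral_mono_on hint hmaj measurableSet_Ioi fun t ht => ?_
  exact srwHeatKernel_zero_rpow_le (le_of_lt (mem_Ioi.1 ht)) hν0

/-- The substitution `t = s/ν`: `ν ∫₀^∞ r(t)^ν dt = ∫₀^∞ r(s/ν)^ν ds` (`ν > 0`); plumbing for
Proposition A.6. [folklore] -/
private theorem mul_integral_srwHeatKernel_zero_rpow {ν : ℝ} (hν : 0 < ν) :
    ν * ∫ t in Ioi (0 : ℝ), srwHeatKernel t 0 ^ ν =
      ∫ s in Ioi (0 : ℝ), srwHeatKernel (s / ν) 0 ^ ν := by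
  have h := integral_comp_mul_left_Ioi (fun t => srwHeatKernel t 0 ^ ν) 0 (inv_pos.2 hν)
  simp only [mul_zero, inv_inv, smul_eq_mul] at h
  have hfun : (fun s : ℝ => srwHeatKernel (s / ν) 0 ^ ν) = fun s => srwHeatKernel (ν⁻¹ * s) 0 ^ ν := by
    funext s; rw [div_eq_inv_mul]
  rw [hfun, h]

/-- The scaled integrand `s ↦ r(s/ν)^ν` is integrable on `(0, ∞)` for `ν > 2`; plumbing for
Proposition A.6. [folklore] -/
private theorem integrableOn_srwHeatKernel_zero_div_rpow {ν : ℝ} (hν : 2 < ν) :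
    IntegrableOn (fun s : ℝ => srwHeatKernel (s / ν) 0 ^ ν) (Ioi 0) := by
  have hν0 : 0 < ν := by linarith
  have h := (integrableOn_Ioi_comp_mul_left_iff (fun t => srwHeatKernel t 0 ^ ν) 0
    (inv_pos.2 hν0)).2 (by simpa using (integrableOn_srwHeatKernel_zero_rpow hν).1)
  have hfun : (fun s : ℝ => srwHeatKernel (s / ν) 0 ^ ν) = fun s => srwHeatKernel (ν⁻¹ * s) 0 ^ ν := by
    funext s; rw [div_eq_inv_mul]
  rw [hfun]
  exact h

/-! ### Proposition A.6 -/

/-- **Salmhofer–Seiler, Proposition A.6** ("Let `ν ∈ ℝ`, `ν ≥ 3`. Then `ν R(ν)` is a decreasing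
function of `ν`", `R(ν) = ∫₀^∞ r(x)^ν dx` being (A.7), the real-`ν` continuation of Remark A.3),
here on the whole natural range `ν > 2`: `ν ↦ ν ∫₀^∞ r(t)^ν dt` is antitone on `(2, ∞)`.
Proof (a shorter road than the printed (A.29)–(A.35), which differentiates under the integral,
integrates by parts twice and analyses the sign of `φ` with the Bessel inequalities (A.21)):
substituting `t = s/ν`, `ν R(ν) = ∫₀^∞ r(s/ν)^ν ds`, and the integrand is pointwise non-increasing in
`ν` because `r` is log-convex with `r(0) = 1` (`srwHeatKernel_zero_div_rpow_le`).
[cite: SalmhoferSeiler1991, Proposition A.6 (p. 427)] -/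
theorem mul_integral_srwHeatKernel_zero_rpow_antitoneOn :
    AntitoneOn (fun ν : ℝ => ν * ∫ t in Ioi (0 : ℝ), srwHeatKernel t 0 ^ ν) (Ioi 2) := by
  intro ν hν ν' hν' hle
  have hν2 : (2 : ℝ) < ν := mem_Ioi.1 hν
  have hν'2 : (2 : ℝ) < ν' := mem_Ioi.1 hν'
  have hν0 : 0 < ν := by linarith
  show ν' * ∫ t in Ioi (0 : ℝ), srwHeatKernel t 0 ^ ν' ≤ ν * ∫ t in Ioi (0 : ℝ), srwHeatKernel t 0 ^ ν
  rw [mul_integral_srwHeatKernel_zero_rpow hν0, mul_integral_srwHeatKernel_zero_rpow (by linarith)]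
  exact setIntegral_mono_on (integrableOn_srwHeatKernel_zero_div_rpow hν'2)
    (integrableOn_srwHeatKernel_zero_div_rpow hν2) measurableSet_Ioi
    fun s _ => srwHeatKernel_zero_div_rpow_le hν0 hle s

/-- Proposition A.6 as printed (`ν, ν'` real, `3 ≤ ν ≤ ν'`): `ν' R(ν') ≤ ν R(ν)`.
[cite: SalmhoferSeiler1991, Proposition A.6] -/
theorem mul_integral_srwHeatKernel_zero_rpow_le_of_le {ν ν' : ℝ} (hν : 3 ≤ ν) (hle : ν ≤ ν') :
    ν' * ∫ t in Ioi (0 : ℝ), srwHeatKernel t 0 ^ ν' ≤ ν * ∫ t in Ioi (0 : ℝ), srwHeatKernel t 0 ^ ν :=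
  mul_integral_srwHeatKernel_zero_rpow_antitoneOn (mem_Ioi.2 (by linarith))
    (mem_Ioi.2 (by linarith)) hle

/-! ### The lattice Green function at the origin: `d R(d)` is non-increasing in `d` -/

/-- (A.7) with a real power: `R(d) = latticeGreen 0 = ∫₀^∞ r(t)^d dt`, `d ≥ 3`
(`latticeGreen_eq_integral_prod_srwHeatKernel` with `∏ᵢ q_t(0) = r(t)^d`).
[cite: SalmhoferSeiler1991, Proposition A.2 (1), (A.7)] -/
theorem latticeGreen_zero_eq_integral_rpow (hd : 3 ≤ d) :
    latticeGreen (0 : Site d) = ∫ t in Ioi (0 : ℝ), srwHeatKernel t 0 ^ (d : ℝ) := by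
  obtain ⟨-, heq⟩ := latticeGreen_eq_integral_prod_srwHeatKernel hd 0
  rw [heq]
  refine setIntegral_congr_fun measurableSet_Ioi fun t _ => ?_
  simp only [Pi.zero_apply, Finset.prod_const, Finset.card_univ, Fintype.card_fin,
    Real.rpow_natCast]

/-- **Proposition A.6 on the lattice: `d' R(d') ≤ d R(d)` for `3 ≤ d ≤ d'`**, where
`R(d) = latticeGreen (0 : Site d) = ∫ d^dk/((2π)^d Σ_μ(1 - cos k_μ))` is the Green function of
`ℤ^d` at the origin (the Fröhlich–Simon–Spencer infrared constant).  In random-walk terms: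
`d R(d) = G_d(0,0) = (1 - F_d)⁻¹` is the expected number of visits to the origin of the simple random
walk on `ℤ^d`, and it does not increase with the dimension. [cite: SalmhoferSeiler1991, Proposition A.6 with (A.7)] -/
theorem dim_mul_latticeGreen_zero_le_of_le {d d' : ℕ} (hd : 3 ≤ d) (hle : d ≤ d') :
    (d' : ℝ) * latticeGreen (0 : Site d') ≤ (d : ℝ) * latticeGreen (0 : Site d) := by
  rw [latticeGreen_zero_eq_integral_rpow hd, latticeGreen_zero_eq_integral_rpow (hd.trans hle)]
  have hd3 : (3 : ℝ) ≤ d := by exact_mod_cast hd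
  have hle' : (d : ℝ) ≤ d' := by exact_mod_cast hle
  exact mul_integral_srwHeatKernel_zero_rpow_le_of_le hd3 hle'

/-- The one-step form: `(d + 1) R(d + 1) ≤ d R(d)` for `d ≥ 3`. [cite: SalmhoferSeiler1991, Proposition A.6] -/
theorem succ_mul_latticeGreen_zero_le (hd : 3 ≤ d) :
    ((d : ℝ) + 1) * latticeGreen (0 : Site (d + 1)) ≤ (d : ℝ) * latticeGreen (0 : Site d) := by
  have h := dim_mul_latticeGreen_zero_le_of_le hd (Nat.le_succ d)
  push_cast at h
  exact h

/-- Consequently `R(d') ≤ (d/d') R(d) ≤ R(d)`: the infrared constant itself is non-increasing in the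
dimension (`3 ≤ d ≤ d'`). [cite: SalmhoferSeiler1991, Proposition A.6] -/
theorem latticeGreen_zero_le_of_le {d d' : ℕ} (hd : 3 ≤ d) (hle : d ≤ d') :
    latticeGreen (0 : Site d') ≤ latticeGreen (0 : Site d) := by
  have h := dim_mul_latticeGreen_zero_le_of_le hd hle
  have hd0 : (0 : ℝ) < d := by exact_mod_cast (show 0 < d by omega)
  have hle' : (d : ℝ) ≤ d' := by exact_mod_cast hle
  have hR : 0 ≤ latticeGreen (0 : Site d) := by
    rw [latticeGreen_zero_eq_integral_rpow hd]
    exact setIntegral_nonneg measurableSet_Ioi fun t _ =>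
      Real.rpow_nonneg (srwHeatKernel_zero_nonneg t) _
  nlinarith

end Literature.Probability.LatticeModels

end
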